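import Summits.QuantumFields.YangMills.Theorems.BalabanUVNodesN15KingModelGraphPowerCountingLog
import Summits.QuantumFields.YangMills.Theorems.BalabanUVNodesN15KingModelGraphPowerCountingSubgraphsIff
import Summits.QuantumFields.YangMills.Theorems.BalabanUVNodesN15KingModelGraphPowerCountingSubgraphsCensus

/-!
# BalabanUVNodes ∕ N15 — THE KING-MODEL RUNG (PART Λ-b): **A GRAPH ALL OF WHOSE SUBGRAPHS HAVE NON-NEGATIVE DEGREE DIVERGES AT MOST LIKE A POWER OF THE LOGARITHM**
# — for a connected graph with King's `A = 0` propagators whose every non-empty connected sub-line-set has degree `≥ 0` (zero allowed: the superficially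
# log-divergent subgraphs King's §3.5 renormalises), `|E^{(k)}(H)| ≤ Γ·C₁^m·C₂^n·m!·(k+1)^m·Π q` — at most `(log_L η⁻¹ + 1)^m`, by name; King's three-dimensional
# SUNSET (degree `0`, the δm² graph) is the worked instance
# (Track A, DAG node N15 = NE2; FAN-OUT v1.1 §N15 s3 «KING-MODEL RUNG … NE2's analogue DECIDED in the model»)

HONEST FRAMING.  Count-neutral (cell `pub-ymgap`, seat `pub-ymgap-dag-n15-e` g28; `--supports stmt-QuantumFields-27366 --as helper` = K3⁸
`SpineGivenEndpointR13SepCoPHV`).  TEMPLATE LITERATURE: C. King, *The U(1) Higgs model. I. The continuum limit*, Commun. Math. Phys. **102** (1986) 649–677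
[King1986], §3.4 p. 664, §3.5 (3.78)–(3.81) pp. 666–667.  Part Λ-a ★★★ `king_graph_size_log_zeroField_R`: the size of a graph under NON-NEGATIVE partial degrees
along every ordering, with `K + 1` per zero step (certificates as data).  THIS FILE discharges the certificates (Kruskal, part Γ-l) and the ordering (part Δ-a's
identity `D(H_i) = Σ_points D(S_point)`, read with `≥ 0`): the ORDERING-FREE hypothesis «every non-empty connected sub-line-set has degree `≥ 0`» suffices; and
since King's exponents are integers, every positive partial degree is `≥ 1`, so `degConstLog L k ≤ (k + 1)^m` (`L ≥ 2`, `k ≥ 1`) and the orderings sum to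
`m!·(k+1)^m`.  The 3-dimensional sunset (three parallel `G`-lines, degree `3 − 3 = 0` — part Δ-c's negative census) is such a graph: bounded by `const·(k+1)³`.  King's
U(1)∕`A = 0` MODEL; NOT Bałaban's non-abelian `G(U)` of [B9]; NOT a node discharge; nothing continuum ∕ ℝ⁴ ∕ OS ∕ mass-gap ∕ Clay.  0 `sorry`; standard axioms.
THE PRINT.  p. 666 [PDF 18]: *«Therefore the graph H_ren is bounded as before, with the possible addition of some power of ln(L^kε)^{−1}.»*; p. 667 [PDF 19]: *«We will
prove (3.77) and (3.78) for one linearly divergent self-energy diagram for the scalar field … The graph in δm² corresponding to the diagram is the following (3.81)»*.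
WHAT THIS FILE PROVES.
* §1 (ns `…Graph`) `NonnegSubgraphs src tgt dV e` (every non-empty connected sub-line-set has `D(S) ≥ 0`), ★ `prefixDeg_nonneg_of_nonnegSubgraphs` (⇒ `D(H_i) ≥ 0`
  for every ordering and every `i`), `nonneg_subDeg_GLines_of_cert` ∕ ★ `nonnegSubgraphs_GLines_of_cert` (the INTEGER certificate `(d−1)|S| + d + 1 ≤ (d+1)|V(S)|`,
  decidable), the sunset `sunSrc`∕`sunTgt` (three lines `0 → 1`), `lConn_sunset`, `nonnegCert_sunset_two` (`d = 2`, by `decide`).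
* §2 (ns `…Curved`) `nonnegDegrees_ofFn_of_forall`, `nonnegDegrees_ofFn_rev_of_prefix`, ★ `nonnegDegrees_kingDegList_of_nonnegSubgraphs`.
* §3 `posDegreesAtLeast_one_of_int`, ★ `degConstLog_le_pow_succ_of_int` (`degConstLog L K es ≤ (K+1)^{|es|}` for integer exponents, `L ≥ 2`, `K ≥ 1`),
  `length_kingDegList`, ★ `sum_degConstLog_kingDegList_le` (`Σ_π degConstLog L k (kingDegList …) ≤ m!·(k+1)^m`).
* §4 ★★★ **`king_graph_size_log_zeroField_subgraphs`** — for CONNECTED graphs with `NonnegSubgraphs src tgt (d+1) (lineExp ∘ κ)`: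
  `|E^{(k)}(H)| ≤ Γ·C₁^m·C₂^n·(m!·(k+1)^m)·Π_{υ≠υ₀} q_υ` («some power of ln(L^kε)^{−1}» — here at most the `m`-th).
* §5 ★★ **`king_graph_size_log_sunset`** — King's 3-dimensional sunset (`d = 2`, vertices `0, 1`, three `G`-lines): `|E^{(k)}| ≤ Γ·C₁³·C₂·(3!·(k+1)³)·Π q`.
HONEST SCOPE.  (a) An UPPER bound by a power of the number of scales; no lower bound (that the sunset DOES diverge) and no rate; the power `m` is crude (one factor
per line, King: one per divergent subgraph).  (b) `G`∕`∂G` lines, abstract one-vertex factors, root factor in `L¹`; King's U(1)∕`A = 0` model; NOT Bałaban's `G(U)`;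
NE2∕N15 of record untouched; counts unmoved.  Locators: [King1986] p.664, (3.78)–(3.81) pp.666–667.
-/
noncomputable section

namespace Summit.QuantumFields.YangMills.BalabanUVNodes.N15KingModelRung.Graph

open scoped BigOperators
open Finset

/-! ## §1 Non-negative subgraph degrees; the integer certificate; the sunset -/

section Nonneg
variable {nn m : ℕ} (src tgt : Fin m → Fin (nn + 1))

/-- **EVERY NON-EMPTY CONNECTED SUB-LINE-SET HAS NON-NEGATIVE DEGREE** (zero allowed: superficially log-divergent subgraphs).
[cite: King1986, p.664 («Some of the subgraphs H_i may be divergent»), (3.78) p.666] -/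
def NonnegSubgraphs (dV : ℝ) (e : Fin m → ℝ) : Prop :=
  ∀ S : Finset (Fin m), S.Nonempty → (∀ u ∈ lineVerts src tgt S, ∀ v ∈ lineVerts src tgt S, LConn src tgt S u v) → 0 ≤ subDeg src tgt dV e S

variable {src tgt}

/-- ★ **THEN EVERY `D(H_i)` ALONG EVERY ORDERING IS NON-NEGATIVE** (part Δ-a: `D(H_i)` is a sum of degrees of non-empty connected sub-line-sets).
[cite: King1986, (3.66) p.664, (3.78) p.666] -/
theorem prefixDeg_nonneg_of_nonnegSubgraphs {dV : ℝ} {e : Fin m → ℝ} (h : NonnegSubgraphs src tgt dV e) (π : Equiv.Perm (Fin m)) (i : ℕ) :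
    0 ≤ prefixDeg src tgt dV e π i := by
  classical
  rw [prefixDeg_eq_sum_subDeg]
  exact sum_nonneg fun c hc => h _ (labelLines_nonempty hc) fun u hu v hv => lConn_labelLines hu hv

/-- the integer certificate `(d−1)|S| + d + 1 ≤ (d+1)|V(S)|` gives `D(S) ≥ 0` for `G`-lines (`e ≡ 2 − (d+1)`, `1 ≤ d`). [cite: King1986, p.664] -/
theorem nonneg_subDeg_GLines_of_cert {d : ℕ} (hd1 : 1 ≤ d)
    (h : ∀ S : Finset (Fin m), S.Nonempty → (d - 1) * S.card + d + 1 ≤ (d + 1) * (lineVerts src tgt S).card)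
    (S : Finset (Fin m)) (hS : S.Nonempty) : 0 ≤ subDeg src tgt ((d + 1 : ℕ) : ℝ) (fun _ => 2 - ((d + 1 : ℕ) : ℝ)) S := by
  have h' := h S hS
  have hcast : (((d - 1 : ℕ) : ℝ)) = (d : ℝ) - 1 := by rw [Nat.cast_sub hd1, Nat.cast_one]
  have h'' : ((d : ℝ) - 1) * (S.card : ℝ) + d + 1 ≤ ((d : ℝ) + 1) * ((lineVerts src tgt S).card : ℝ) := by
    rw [← hcast]; exact_mod_cast h'
  rw [subDeg_const]
  push_cast
  nlinarith

/-- ★ **THE INTEGER CERTIFICATE GIVES `NonnegSubgraphs` FOR `G`-LINES.** [cite: King1986, p.664] -/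
theorem nonnegSubgraphs_GLines_of_cert {d : ℕ} (hd1 : 1 ≤ d)
    (h : ∀ S : Finset (Fin m), S.Nonempty → (d - 1) * S.card + d + 1 ≤ (d + 1) * (lineVerts src tgt S).card) :
    NonnegSubgraphs src tgt ((d + 1 : ℕ) : ℝ) (fun _ => 2 - ((d + 1 : ℕ) : ℝ)) :=
  fun S hS _ => nonneg_subDeg_GLines_of_cert hd1 h S hS

/-- KING's SUNSET: three parallel lines `0 → 1` (external vertex `0`, one internal vertex). [cite: King1986, (3.81) p.667] -/
def sunSrc : Fin 3 → Fin 2 := ![0, 0, 0]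

/-- the sunset's targets. [cite: King1986, (3.81) p.667] -/
def sunTgt : Fin 3 → Fin 2 := ![1, 1, 1]

/-- the sunset is connected to its external vertex. [folklore] -/
theorem lConn_sunset : ∀ v : Fin 2, LConn sunSrc sunTgt univ 0 v := by
  intro v
  fin_cases v
  · exact Relation.EqvGen.refl _
  · exact Relation.EqvGen.rel _ _ ⟨0, mem_univ _, rfl, rfl⟩

/-- **IN THREE DIMENSIONS THE SUNSET's SUBGRAPHS HAVE NON-NEGATIVE DEGREE** (`d = 2`: `|S| + 3 ≤ 3|V(S)| = 6` for `|S| = 1, 2, 3`; degrees `2, 1, 0`), by `decide`.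
[cite: King1986, p.664, (3.81) p.667] -/
theorem nonnegCert_sunset_two :
    ∀ S : Finset (Fin 3), S.Nonempty → (2 - 1) * S.card + 2 + 1 ≤ (2 + 1) * (lineVerts sunSrc sunTgt S).card := by decide

end Nonneg

end Summit.QuantumFields.YangMills.BalabanUVNodes.N15KingModelRung.Graph

namespace Summit.QuantumFields.YangMills.BalabanUVNodes.N15KingModelRung.Curved

open scoped BigOperators
open Finset
open Literature.MathematicalPhysics.QuantumFieldTheory.Balaban1983to89.B5Prop11Plancherel (Tor fine unitVec)
open Summit.QuantumFields.YangMills.BalabanUVNodes.N15KingModelRung.Graph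

variable (L : ℕ)

/-! ## §2 Non-negative degrees along every ordering from the subgraph condition -/

section Lists

omit L in
/-- suffix sums `≥ 0` give `NonnegDegrees` for a `List.ofFn`. [cite: King1986, (3.78) p.666] -/
theorem nonnegDegrees_ofFn_of_forall :
    ∀ {n : ℕ} (h : Fin n → ℝ), (∀ p : Fin n, 0 ≤ ∑ q ∈ (univ : Finset (Fin n)).filter (fun q : Fin n => p ≤ q), h q) → NonnegDegrees (List.ofFn h)
  | 0, _, _ => by rw [List.ofFn_zero]; trivial
  | n + 1, h, H => by
      rw [List.ofFn_succ]
      refine ⟨?_, ?_⟩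
      · have h0 := H 0
        have hall : (univ : Finset (Fin (n + 1))).filter (fun q : Fin (n + 1) => (0 : Fin (n + 1)) ≤ q) = univ :=
          filter_true_of_mem fun q _ => Fin.zero_le q
        rw [hall] at h0
        rw [List.sum_ofFn, ← Fin.sum_univ_succ]
        exact h0
      · refine nonnegDegrees_ofFn_of_forall (fun i : Fin n => h i.succ) fun p => ?_
        have hp := H p.succ
        rw [sum_filter, Fin.sum_univ_succ, if_neg (not_le.2 (Fin.succ_pos p)), zero_add] at hp
        rw [sum_filter]
        refine le_of_le_of_eq hp (sum_congr rfl fun i _ => ?_)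
        simp only [Fin.succ_le_succ_iff]

omit L in
/-- the prefix form for the reversed list. [cite: King1986, (3.78) p.666] -/
theorem nonnegDegrees_ofFn_rev_of_prefix {m : ℕ} (g : Fin m → ℝ)
    (H : ∀ i : ℕ, i ≤ m → 0 ≤ ∑ q ∈ (univ : Finset (Fin m)).filter (fun q : Fin m => ((q : ℕ)) < i), g q) :
    NonnegDegrees (List.ofFn fun p : Fin m => g (Fin.rev p)) := by
  refine nonnegDegrees_ofFn_of_forall (fun p : Fin m => g (Fin.rev p)) fun p => ?_
  rw [sum_filter_le_comp_rev g p]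
  exact H (m - p) (Nat.sub_le m p)

/-- ★ **NON-NEGATIVE SUBGRAPH DEGREES ⇒ NON-NEGATIVE `D(H_i)` ALONG EVERY ORDERING** (`NonnegDegrees (kingDegList …)`). [cite: King1986, p.664, (3.78) p.666] -/
theorem nonnegDegrees_kingDegList_of_nonnegSubgraphs {nn m : ℕ} {src tgt : Fin m → Fin (nn + 1)} {dV : ℝ} {e : Fin m → ℝ}
    (h : NonnegSubgraphs src tgt dV e) (π : Equiv.Perm (Fin m)) : NonnegDegrees (kingDegList src tgt dV e π) := by
  rw [kingDegList_eq_ofFn]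
  refine nonnegDegrees_ofFn_rev_of_prefix (fun q : Fin m => e (π q) + if IsTreePos src tgt π q then dV else 0) fun i _ => ?_
  rw [kingDegList_prefix_eq_prefixDeg]
  exact prefixDeg_nonneg_of_nonnegSubgraphs h π i

end Lists

/-! ## §3 Counting the logarithms for integer exponents -/

section IntCount

omit L in
/-- for integer entries every positive partial degree is `≥ 1`. [cite: King1986, (3.78) p.666] -/
theorem posDegreesAtLeast_one_of_int : ∀ {es : List ℝ}, (∀ x ∈ es, ∃ z : ℤ, x = (z : ℝ)) → PosDegreesAtLeast 1 es
  | [], _ => trivial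
  | e :: es, hint => by
      refine ⟨fun hpos => ?_, posDegreesAtLeast_one_of_int fun x hx => hint x (List.mem_cons_of_mem e hx)⟩
      obtain ⟨z, hz⟩ := exists_int_list_sum (es := e :: es) hint
      rw [List.sum_cons] at hz
      rw [hz] at hpos ⊢
      have hz1 : (1 : ℤ) ≤ z := by exact_mod_cast hpos
      exact_mod_cast hz1

/-- ★ **AT MOST ONE FACTOR «NUMBER OF SCALES» PER LINE**: for integer exponents, `L ≥ 2` and `K ≥ 1`, `degConstLog L K es ≤ (K + 1)^{|es|}` (the geometric constant
of a positive step is `≤ (1 − L^{−1})^{−1} ≤ 2 ≤ K + 1`). [cite: King1986, p.666 («some power of ln(L^kε)^{−1}»)] -/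
theorem degConstLog_le_pow_succ_of_int (hL : 2 ≤ L) {K : ℕ} (hK : 1 ≤ K) {es : List ℝ} (hint : ∀ x ∈ es, ∃ z : ℤ, x = (z : ℝ)) :
    degConstLog L K es ≤ ((K : ℝ) + 1) ^ es.length := by
  have h := degConstLog_le_pow L hL K one_pos (posDegreesAtLeast_one_of_int hint)
  have hL2 : (2 : ℝ) ≤ L := by exact_mod_cast hL
  have hK1 : (1 : ℝ) ≤ K := by exact_mod_cast hK
  have hgeom : (1 - (L : ℝ) ^ (-(1 : ℝ)))⁻¹ ≤ (K : ℝ) + 1 := by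
    rw [Real.rpow_neg_one]
    have hLinv : (L : ℝ)⁻¹ ≤ 2⁻¹ := inv_anti₀ two_pos hL2
    have hhalf : (2 : ℝ)⁻¹ ≤ 1 - (L : ℝ)⁻¹ := by norm_num at hLinv ⊢; linarith
    calc (1 - (L : ℝ)⁻¹)⁻¹ ≤ ((2 : ℝ)⁻¹)⁻¹ := inv_anti₀ (by norm_num) hhalf
      _ = 2 := by norm_num
      _ ≤ (K : ℝ) + 1 := by linarith
  rwa [max_eq_right hgeom] at h

omit L in
/-- King's exponent list has one entry per line. [folklore] -/
theorem length_kingDegList {nn m : ℕ} (src tgt : Fin m → Fin (nn + 1)) (dV : ℝ) (e : Fin m → ℝ) (π : Equiv.Perm (Fin m)) :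
    (kingDegList src tgt dV e π).length = m := by
  unfold kingDegList
  exact List.length_ofFn

/-- ★ **THE ORDERINGS SUM TO `m!·(k+1)^m`** for King's integer exponents (`dV = dd`, `e ∈ {2 − dd, 1 − dd}`). [cite: King1986, p.666] -/
theorem sum_degConstLog_kingDegList_le (hL : 2 ≤ L) {k : ℕ} (hk : 1 ≤ k) {nn m : ℕ} (src tgt : Fin m → Fin (nn + 1)) (dd : ℕ)
    (κ : Fin m → Option (Fin dd)) :
    ∑ π : Equiv.Perm (Fin m), degConstLog L k (kingDegList src tgt ((dd : ℕ) : ℝ) (fun ℓ => lineExp dd (κ ℓ)) π)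
      ≤ (m.factorial : ℝ) * ((k : ℝ) + 1) ^ m := by
  calc ∑ π : Equiv.Perm (Fin m), degConstLog L k (kingDegList src tgt ((dd : ℕ) : ℝ) (fun ℓ => lineExp dd (κ ℓ)) π)
      ≤ ∑ _π : Equiv.Perm (Fin m), ((k : ℝ) + 1) ^ m := by
        refine sum_le_sum fun π _ => ?_
        have h := degConstLog_le_pow_succ_of_int L hL hk
          (kingDegList_int (src := src) (tgt := tgt) ⟨(dd : ℤ), by push_cast; rfl⟩ (fun ℓ => lineExp_int dd (κ ℓ)) π)
        rwa [length_kingDegList] at h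
    _ = (m.factorial : ℝ) * ((k : ℝ) + 1) ^ m := by
        rw [sum_const, card_univ, Fintype.card_perm, Fintype.card_fin, nsmul_eq_mul]

end IntCount

/-! ## §4 The size of a graph with non-negative subgraph degrees: at most a power of the logarithm -/

section SizeLogSubgraphs
variable {d : ℕ} [NeZero L]

/-- ★★★ **A CONNECTED GRAPH ALL OF WHOSE NON-EMPTY CONNECTED SUB-LINE-SETS HAVE NON-NEGATIVE DEGREE IS BOUNDED BY A POWER OF THE NUMBER OF SCALES** — King's «bounded
as before, with the possible addition of some power of ln(L^kε)^{−1}» for graphs with superficially log-divergent subgraphs, at `A = 0`: for odd `L ≥ 3`, `a > 0`,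
`m₀² ≥ 0` there are `C₁, C₂ > 0` such that for every `k ≥ 1`, cube `M = 2L^{e_M}`, mass `0 < m² ≤ m₀²`, every CONNECTED numbered graph (lines `G^η_k`∕`∂^η_μG^η_k`) with
`NonnegSubgraphs src tgt (d+1) (lineExp ∘ κ)`, one-vertex factors with sizes `q_υ` and a root-placed factor with `Σ_x η^{d+1}|u_{υ₀}(x)| ≤ Γ`:
`|E^{(k)}(H)| ≤ Γ·C₁^m·C₂^n·(m!·(k+1)^m)·Π_{υ≠υ₀} q_υ` — part Λ-a with Kruskal's certificates (part Γ-l), the ordering discharged by §2, the logarithms counted by §3.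
[cite: King1986, p.664, (3.66) p.663, (3.78)–(3.80) p.666] -/
theorem king_graph_size_log_zeroField_subgraphs (hLodd : Odd L) (hL : 2 ≤ L) {a : ℝ} (ha : 0 < a) {m0sq : ℝ} (hm0 : 0 ≤ m0sq) :
    ∃ C₁ C₂ : ℝ, 0 < C₁ ∧ 0 < C₂ ∧ ∀ (k eM : ℕ) (hk : 1 ≤ k) (M : Fin (d + 1) → ℕ) [∀ μ, NeZero (M μ)] (hM : ∀ μ, M μ = 2 * L ^ eM)
      (msq : ℝ), 0 < msq → msq ≤ m0sq →
      ∀ (n m : ℕ) (src tgt : Fin m → Fin (n + 1)), (∀ v, LConn src tgt univ 0 v) →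
      ∀ (κ : Fin m → Option (Fin (d + 1))), NonnegSubgraphs src tgt ((d + 1 : ℕ) : ℝ) (fun ℓ => lineExp (d + 1) (κ ℓ)) →
      ∀ (Υ : Type) [Fintype Υ] [DecidableEq Υ] (vtx : Υ → Fin (n + 1)) (u : Υ → Tor (fine (L ^ k) M) → ℝ) (q : Υ → ℝ) (υ₀ : Υ) (Γ : ℝ),
        vtx υ₀ = 0 → (∀ υ, υ ≠ υ₀ → ∀ x, |u υ x| ≤ q υ) → (∑ x, (((L : ℝ) ^ k)⁻¹) ^ (d + 1) * |u υ₀ x| ≤ Γ) →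
          |graphValLS ((((L : ℝ) ^ k)⁻¹) ^ (d + 1)) src tgt (fun ℓ => kingGLine L M a msq k (κ ℓ)) vtx u|
            ≤ Γ * (C₁ ^ m * C₂ ^ n * ((m.factorial : ℝ) * ((k : ℝ) + 1) ^ m) * ∏ υ ∈ univ.erase υ₀, q υ) := by
  obtain ⟨C₁, C₂, hC₁, hC₂, H⟩ := king_graph_size_log_zeroField_R (d := d) L hLodd hL ha hm0
  refine ⟨C₁, C₂, hC₁, hC₂, fun k eM hk M _ hM msq hm hcap n m src tgt hconn κ hsub Υ _ _ vtx u q υ₀ Γ hυ₀ hq hΓ => ?_⟩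
  classical
  -- Kruskal's certificates, one per ordering; their order lists are King's exponent lists
  have hex := fun π : Equiv.Perm (Fin m) => exists_certR_kruskal hconn π
  have hord : ∀ π, orderList ((d + 1 : ℕ) : ℝ) (fun ℓ => lineExp (d + 1) (κ ℓ)) π (Classical.choose (hex π)).F
      = kingDegList src tgt ((d + 1 : ℕ) : ℝ) (fun ℓ => lineExp (d + 1) (κ ℓ)) π :=
    fun π => orderList_eq_kingDegList _ _ π _ (Classical.choose_spec (hex π))
  have hnn : ∀ π, NonnegDegrees (orderList ((d + 1 : ℕ) : ℝ) (fun ℓ => lineExp (d + 1) (κ ℓ)) π (Classical.choose (hex π)).F) := fun π => by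
    rw [hord π]; exact nonnegDegrees_kingDegList_of_nonnegSubgraphs hsub π
  have h := H k eM hk M hM msq hm hcap n m src tgt κ Υ vtx u q υ₀ Γ hυ₀ hq hΓ (fun π => Classical.choose (hex π)) hnn
  refine h.trans ?_
  -- count the logarithms
  have hsum : ∑ π : Equiv.Perm (Fin m), degConstLog L k (orderList ((d + 1 : ℕ) : ℝ) (fun ℓ => lineExp (d + 1) (κ ℓ)) π (Classical.choose (hex π)).F)
      ≤ (m.factorial : ℝ) * ((k : ℝ) + 1) ^ m := by
    rw [sum_congr rfl fun π _ => by rw [hord π]]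
    exact sum_degConstLog_kingDegList_le L hL hk src tgt (d + 1) κ
  -- signs
  haveI : Nonempty (Tor (fine (L ^ k) M)) := ⟨fun _ => 0⟩
  obtain ⟨x₀⟩ := ‹Nonempty (Tor (fine (L ^ k) M))›
  have hΓ0 : 0 ≤ Γ := (sum_nonneg fun x _ => mul_nonneg (by positivity) (abs_nonneg _)).trans hΓ
  have hq0 : 0 ≤ ∏ υ ∈ univ.erase υ₀, q υ := prod_nonneg fun υ hυ => (abs_nonneg _).trans (hq υ (ne_of_mem_erase hυ) x₀)
  have hC0 : 0 ≤ C₁ ^ m * C₂ ^ n := mul_nonneg (pow_nonneg hC₁.le _) (pow_nonneg hC₂.le _)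
  exact mul_le_mul_of_nonneg_left (mul_le_mul_of_nonneg_right (mul_le_mul_of_nonneg_left hsum hC0) hq0) hΓ0

end SizeLogSubgraphs

/-! ## §5 King's sunset -/

section Sunset

variable [NeZero L]

/-- ★★ **KING's THREE-DIMENSIONAL SUNSET IS BOUNDED BY `const·(k+1)³`** (`d = 2`): the graph of three parallel `G`-lines between the external vertex `0` and one
internal vertex — degree `3·1 − 3 = 0`, the δm² graph of (3.81) — satisfies `|E^{(k)}| ≤ Γ·C₁³·C₂·(3!·(k+1)³)·Π q`: divergent at most like the cube of the
number of scales, by theorem (King renormalises it; here it is only bounded). [cite: King1986, (3.81) p.667, p.666] -/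
theorem king_graph_size_log_sunset (hLodd : Odd L) (hL : 2 ≤ L) {a : ℝ} (ha : 0 < a) {m0sq : ℝ} (hm0 : 0 ≤ m0sq) :
    ∃ C₁ C₂ : ℝ, 0 < C₁ ∧ 0 < C₂ ∧ ∀ (k eM : ℕ) (hk : 1 ≤ k) (M : Fin (2 + 1) → ℕ) [∀ μ, NeZero (M μ)] (hM : ∀ μ, M μ = 2 * L ^ eM)
      (msq : ℝ), 0 < msq → msq ≤ m0sq →
      ∀ (Υ : Type) [Fintype Υ] [DecidableEq Υ] (vtx : Υ → Fin (1 + 1)) (u : Υ → Tor (fine (L ^ k) M) → ℝ) (q : Υ → ℝ) (υ₀ : Υ) (Γ : ℝ),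
        vtx υ₀ = 0 → (∀ υ, υ ≠ υ₀ → ∀ x, |u υ x| ≤ q υ) → (∑ x, (((L : ℝ) ^ k)⁻¹) ^ (2 + 1) * |u υ₀ x| ≤ Γ) →
          |graphValLS ((((L : ℝ) ^ k)⁻¹) ^ (2 + 1)) sunSrc sunTgt (fun _ => kingGLine L M a msq k none) vtx u|
            ≤ Γ * (C₁ ^ 3 * C₂ ^ 1 * (((Nat.factorial 3 : ℕ) : ℝ) * ((k : ℝ) + 1) ^ 3) * ∏ υ ∈ univ.erase υ₀, q υ) := by
  obtain ⟨C₁, C₂, hC₁, hC₂, H⟩ := king_graph_size_log_zeroField_subgraphs (d := 2) L hLodd hL ha hm0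
  refine ⟨C₁, C₂, hC₁, hC₂, fun k eM hk M _ hM msq hm hcap Υ _ _ vtx u q υ₀ Γ hυ₀ hq hΓ => ?_⟩
  have hsub : NonnegSubgraphs sunSrc sunTgt ((2 + 1 : ℕ) : ℝ) (fun ℓ => lineExp (2 + 1) ((fun _ : Fin 3 => (none : Option (Fin (2 + 1)))) ℓ)) := by
    rw [show (fun ℓ => lineExp (2 + 1) ((fun _ : Fin 3 => (none : Option (Fin (2 + 1)))) ℓ)) = fun _ => (2 : ℝ) - ((2 + 1 : ℕ) : ℝ)
      from funext fun _ => lineExp_none]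
    exact nonnegSubgraphs_GLines_of_cert (by norm_num) nonnegCert_sunset_two
  exact H k eM hk M hM msq hm hcap 1 3 sunSrc sunTgt lConn_sunset (fun _ => none) hsub Υ vtx u q υ₀ Γ hυ₀ hq hΓ

end Sunset

end Summit.QuantumFields.YangMills.BalabanUVNodes.N15KingModelRung.Curved

end
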